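import Summits.QuantumFields.YangMills.Theorems.BalabanUVNodesK0V23Stub3RunwiseSuppliersAx
import Summits.QuantumFields.YangMills.Theorems.BalabanUVNodesK0RecordFormatNamesLemmas5
import Summits.QuantumFields.YangMills.Theses.BalabanUVNodes

/-!
# PORT helper (K0ᴬ JOIN lineage `ymgap-nodeO-port-PTC-1`, g3; INTENT-17) — THE DECAY ROAD's LAST LINK AT K0ᴬ: one DECAY-ON-RUNS letter `RecordPlimDecayOnRunsAx F a₀ ε₂₉ γ₀ C δ₁`
# per family and radius ⟹ the re-centred run-wise core ⟹ K0ᴬ's BODY at every family (the decl-by-name terminus is ✓`K0V23Stub3CofinalRunDoorAx.…_allRadii`, cited, not restated)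

AUTHORSHIP ∕ CREDIT.  The mathematics and the Lean text of this file are ◇ LENS-1's (planner seat `ymgap-nodeO-lens-1` g5, lens «cauchy-analytic»), HOME deposit
`pub/ym-nodeO-ideate/nodeO-cover/LENS-1-K0AxDecayLink-v1.lean` (sha16 fdb14414a823be99 · 88 l. · 5 thm · 0 def; farm rc 0 · 0 warn · 0 sorry; axioms standard, CANDIDATE-10 nodeO STATUS 2026-08-31T03:57:24Z), theorems 1–4 landed VERBATIM
(header differs; theorem 5 = the decl-by-name terminus is cited from the tree instead, see the last section) by porter PTC-1 g3 keyed
`--supports stmt-QuantumFields-27238 --as helper` (K0ᴬ; no `--workitem`, R615) on lens-1's ASK «by dag-n07-w3 (H3.3) or PTC-1 (INTENT-17)».  Re-based on ▶ dag-n07-w3 g22's tree file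
`…K0V23Stub3RunwiseSuppliersAx` (H3.3, 2026-08-31T03:49Z: the RE-CENTRED run-wise door `k0Body_of_seam_of_runwiseZB`), which this file does NOT duplicate; the decay letter is the
OUTPUT currency of the slot-8 → K0 road's tree JOIN (✓p807054 `PortHRecordJoin.joinGoalL_of_texts_final`, ✓p809004∕`…PortHRecordJoinWith` token-parametric `joinGoalWith_of_texts`).
This file imports the route file LEGITIMATELY: its conclusion IS the K0ᴬ crux decl by name; it unfolds no port-row decl body (docket O-8 hazard does not apply).

CONTENT (5 theorems, 0 def ∕ sorry ∕ instance ∕ notation):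
* `betaOfRecord₁₃Ax_thm1WitnessAx_eq_thetaFill` (`rfl`): `β₁₃ᴬˣ(θᴬˣ(j; ½; a₀; ε₀, ε₂₉, B₃, B₃′, a₀, a₁; Efl, logz)) = β₁₃ᴬˣ(thetaFill F a₀ ε₂₉)` — DEF-1's run letters at `thetaFill`
  (`K0RecordFormatNames.runAbs_of_recordPlimDecayOnRunsAx`, Lemmas5) ARE run letters at V24's re-centred witness; `…_eq_thm1Witness`: the two «Ax» readings in the tree
  (`betaOfRecord₁₃Ax F 2 (theta13OfThm1CCMWZBAx …)` of V24 ∕ `…RunwiseSuppliersAx`, and `betaOfRecord₁₃Ax F 2 (theta13OfThm1CCMWZB …)` of Lemmas4∕5) name ONE β.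
* `runCoreAx_of_recordPlimDecayOnRunsAx`: for `F`, «∀ a₀ > 0, ∃ γ₀ ε₂₉ C δ₁, 0 < γ₀ ≤ ½, 0 < ε₂₉, RecordPlimDecayOnRunsAx F a₀ ε₂₉ γ₀ C δ₁» ⟹ the `run` binder of
  `K0V23Stub3RunwiseSuppliersAx.k0Body_of_runwiseZB_byName` for `F`, with `β′ := B12Sec2to5.betaPrime510 4 C δ₁` ([I] (1.22) second moment of a (5.10)-decaying kernel, (5.42)).
* ★★★ `k0BodyAx_of_recordPlimDecayOnRunsAx` ∕ `record13SepCoPHInhabitedAx_of_recordPlimDecayOnRunsAx`: K0ᴬ's body at every family ∕ THE CRUX DECL BY NAME from that ONE letter per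
  family and radius (stub 1ᴮ PROVED, stub 2′ green, seam `hseamAx_rfl` — all inside the tree door).

WHY.  V24's registered stub 3ᴬ′ᴮ is a β-BOX; the slot-8 → K0 decay road (JOIN ✓p807054 `PortHRecordJoin.joinGoalL_of_texts_final`, token-parametric `joinGoalWith_of_texts`) outputs
`RecordPlimDecayOnRunsAx`, i.e. RUN currency, and runs ⟹̸ box (`K0V23Stub3RunBoxEquivalence.exists_hbeta_runAbs_not_box`).  With the tree's re-centred run-wise door and this link the
road has a typed terminus at K0ᴬ that needs neither the box nor K3ᴬ's kernel letters.
HONESTY.  CONDITIONAL on the displayed decay letter (NODE O's wall in decay currency — what the JOIN delivers modulo its own displayed hypotheses hG0 ∕ hUk ∕ hBg ∕ ‴ ∕ Tok-182 ∕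
Tok-cmpU-cap and the (1.21)-Ax proviso `RecordPolLimitOnRunsAx`); nothing of Bałaban is discharged; K0ᴬ (stmt-QuantumFields-27238) stays OPEN; the mass gap is NOT proved.
[I] = [Balaban1987RG1]; [C] = [Balaban1988Convergent]; [V] = [Balaban1985Variational]; [RS] = [Balaban1985RegularSpaces].
-/

noncomputable section

open MeasureTheory
open scoped Matrix.Norms.L2Operator

namespace Summit.QuantumFields.YangMills.Theorems.K0RecordDecayRoadAx

open Literature.MathematicalPhysics.QuantumFieldTheory.Balaban1983to89
open Literature.MathematicalPhysics.QuantumFieldTheory.Balaban1983to89.Node00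
open Literature.MathematicalPhysics.QuantumFieldTheory.Balaban1983to89.T4Continuum
open Literature.MathematicalPhysics.QuantumFieldTheory.Balaban1983to89.FlowStep
open Literature.MathematicalPhysics.QuantumFieldTheory.Balaban1983to89.FlowStepRuns
open Summit.QuantumFields.YangMills.Theorems.K0AllTorusOfStepTokensGuardedZBLamAx (hseamAx_rfl)
open Summit.QuantumFields.YangMills.Theorems.K0V23Stub3RunwiseSuppliersAx (k0Body_of_seam_of_runwiseZB)
open Summit.QuantumFields.YangMills.Theorems.K0RecordFormatNames

/-- **THE RE-CENTRED WITNESS's β OF RECORD IS THE FILL's** (`rfl`): `β₁₃ᴬˣ(θᴬˣ(j; ½; a₀; ε₀, ε₂₉, B₃, B₃′, a₀, a₁; Efl, logz)) = β₁₃ᴬˣ(thetaFill F a₀ ε₂₉)` — so DEF-1's run letters at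
`thetaFill` ARE run letters at V24's witness. [cite: Balaban1987RG1, (1.20)–(1.22) p.264, (2.9) p.266 (bookkeeping)] -/
theorem betaOfRecord₁₃Ax_thm1WitnessAx_eq_thetaFill (F : T4Family) (j : ℕ) (a₀ ε₀ ε₂₉ B₃ B₃' a₁ : ℝ) (Efl logz : B12.RunParams → ℕ → ℝ) :
    betaOfRecord₁₃Ax F 2 (theta13OfThm1CCMWZBAx F 2 j (1 / 2) a₀ ε₀ ε₂₉ B₃ B₃' a₀ a₁ Efl logz) = betaOfRecord₁₃Ax F 2 (thetaFill F a₀ ε₂₉) := rfl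

/-- … hence equals DEF-1's reading at the NON-re-pinned θ-witness (`Lemmas4.betaOfRecord₁₃Ax_thm1Witness_eq_thetaFill`): the two «Ax» readings in the tree name ONE β.
[cite: Balaban1987RG1, (1.20)–(1.22) p.264, (2.9) p.266 (bookkeeping)] -/
theorem betaOfRecord₁₃Ax_thm1WitnessAx_eq_thm1Witness (F : T4Family) (j : ℕ) (a₀ ε₀ ε₂₉ B₃ B₃' a₁ : ℝ) :
    betaOfRecord₁₃Ax F 2 (theta13OfThm1CCMWZBAx F 2 j (1 / 2) a₀ ε₀ ε₂₉ B₃ B₃' a₀ a₁ (fun _ _ => 0) (fun _ _ => 0)) =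
      betaOfRecord₁₃Ax F 2 (theta13OfThm1CCMWZB F 2 j (1 / 2) a₀ ε₀ ε₂₉ B₃ B₃' a₀ a₁ (fun _ _ => 0) (fun _ _ => 0)) :=
  (betaOfRecord₁₃Ax_thm1WitnessAx_eq_thetaFill F j a₀ ε₀ ε₂₉ B₃ B₃' a₁ _ _).trans
    (betaOfRecord₁₃Ax_thm1Witness_eq_thetaFill (F := F) (a₀ := a₀) (ε₂₉ := ε₂₉) j ε₀ B₃ B₃' a₁).symm

/-- **★ THE RE-CENTRED RUN-WISE CORE FOR `F` FROM ONE DECAY-ON-RUNS LETTER PER RADIUS** (`γ₀ ≤ ½`): `RecordPlimDecayOnRunsAx F a₀ ε₂₉ γ₀ C δ₁` ([I] (5.10)-decay `Decay510 Π C δ₁` of the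
re-centred limit kernel along in-window runs) ⟹ `|β₁₃ᴬˣ| ≤ β′₅₁₀(4, C, δ₁)` along those runs (`runAbs_of_recordPlimDecayOnRunsAx`: [I] (1.22), (5.42)), read at V24's witness by the `rfl`
above — the `run` binder of `K0V23Stub3RunwiseSuppliersAx.k0Body_of_runwiseZB_byName` for `F`.  CONDITIONAL on the decay letter. [cite: Balaban1987RG1, (1.22) p.264, (5.10) p.293, (5.42) p.297, Thm 3 p.264] -/
theorem runCoreAx_of_recordPlimDecayOnRunsAx (F : T4Family)
    (h : ∀ a₀ : ℝ, 0 < a₀ → ∃ γ₀ ε₂₉ C δ₁ : ℝ, 0 < γ₀ ∧ γ₀ ≤ 1 / 2 ∧ 0 < ε₂₉ ∧ RecordPlimDecayOnRunsAx F a₀ ε₂₉ γ₀ C δ₁) :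
    ∀ a₀ : ℝ, 0 < a₀ → ∃ γ₀ ε₂₉ β' : ℝ, 0 < γ₀ ∧ 0 < ε₂₉ ∧ ∀ (j : ℕ) (ε₀ B₃ B₃' a₁ : ℝ),
      ∀ (n : ℕ) (gs : ℕ → ℝ), RGEqH n (betaOfRecord₁₃Ax F 2 (theta13OfThm1CCMWZBAx F 2 j (1 / 2) a₀ ε₀ ε₂₉ B₃ B₃' a₀ a₁ (fun _ _ => 0) (fun _ _ => 0))) gs → Step.InInterval γ₀ n gs →
        ∀ k, k ≤ n → |betaOfRecord₁₃Ax F 2 (theta13OfThm1CCMWZBAx F 2 j (1 / 2) a₀ ε₀ ε₂₉ B₃ B₃' a₀ a₁ (fun _ _ => 0) (fun _ _ => 0)) k (prefixOf gs k)| ≤ β' := by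
  intro a₀ ha₀
  obtain ⟨γ₀, ε₂₉, C, δ₁, hγ₀, hγh, hε, hdec⟩ := h a₀ ha₀
  exact ⟨γ₀, ε₂₉, B12Sec2to5.betaPrime510 4 C δ₁, hγ₀, hε, fun j ε₀ B₃ B₃' a₁ => runAbs_of_recordPlimDecayOnRunsAx F a₀ ε₂₉ hγh hdec⟩

/-- **★★★ K0ᴬ's BODY AT EVERY FAMILY FROM ONE DECAY-ON-RUNS LETTER PER FAMILY AND RADIUS** — the tree's re-centred run-wise door `K0V23Stub3RunwiseSuppliersAx.k0Body_of_seam_of_runwiseZB`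
(stub 1ᴮ PROVED, stub 2′ from the green [6] Prop. 6) at the seam `hseamAx_rfl` and the previous theorem.  CONDITIONAL; K0ᴬ NOT closed; nothing of Bałaban asserted. [cite: Balaban1987RG1, Thm 1 p.259, Thm 3 p.264, (1.22) p.264, (5.10) p.293, (2.9) p.266; Balaban1985Variational, Thm 1 (8)–(9) p.279, Prop. 8 p.304; Balaban1985RegularSpaces, Prop. 6 p.99; Balaban1988Convergent, Thm 1 p.262, (2.6)–(2.8) pp.255–256, (2.12)–(2.13) pp.256–257] -/
theorem k0BodyAx_of_recordPlimDecayOnRunsAx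
    (h : ∀ (F : T4Family) (a₀ : ℝ), 0 < a₀ → ∃ γ₀ ε₂₉ C δ₁ : ℝ, 0 < γ₀ ∧ γ₀ ≤ 1 / 2 ∧ 0 < ε₂₉ ∧ RecordPlimDecayOnRunsAx F a₀ ε₂₉ γ₀ C δ₁) :
    ∀ F : T4Family, ∃ θ : Stage13HParams F 2, θ.Provisos₁₃SepCoPHAx F 2 ∧ (θ.ZhUnity F 2 ∧ θ.SlotsNondegenerate₁₃Ax F 2) ∧ θ.Admissible F 2 :=
  k0Body_of_seam_of_runwiseZB hseamAx_rfl fun F => runCoreAx_of_recordPlimDecayOnRunsAx F (h F)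

/-! ### The terminus by name
The crux decl `Theses.BalabanUVNodes.Record13SepCoPHInhabitedAx` from the all-radii decay letter — lens-1's ★★★ `record13SepCoPHInhabitedAx_of_recordPlimDecayOnRunsAx` (HOME :81) — is
ALREADY IN THE TREE with the identical statement as ✓`K0V23Stub3CofinalRunDoorAx.record13SepCoPHInhabitedAx_of_recordPlimDecayOnRunsAx_allRadii` (★ P3 g87's cofinal door v2, landed
by dag-n20-d g45 at 2026-08-31T04:25Z, factoring T′ through the COFINAL-radii door `K0PiDecayCofinalRadiiAx`); it is therefore NOT restated here (gate `dedup.landed`): cite that name.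
`k0BodyAx_of_recordPlimDecayOnRunsAx` above is its body-level form through the run-wise door directly. -/

end Summit.QuantumFields.YangMills.Theorems.K0RecordDecayRoadAx

end
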